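import Mathlib.MeasureTheory.Measure.GiryMonad
import Literature.Probability.LatticeModels.GibbsSpecification
import HarnessLib

/-!
# DLR equations on a cofinal family of volumes suffice (Georgii 2011, Remark 1.24)

Companion ("Proofs") file of `Literature/Probability/LatticeModels/GibbsSpecification.lean`;
theorems only, no definitions, no named facts.

For a (candidate) specification `γ : Specification V S` whose kernels are measurable in the
boundary condition and **consistent** (`γ_{Λ'} γ_Λ = γ_{Λ'}` for `Λ ⊆ Λ'`, Georgii 2011,
Def. 1.23 (iii) / eq. (1.21)), the DLR equation `μ γ_Λ = μ` for the larger volume `Λ'` implies the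
DLR equation for every `Λ ⊆ Λ'` (Georgii 2011, Remark 1.24: "`μ γ_Λ = μ γ_{Λ'} γ_Λ = μ γ_{Λ'} = μ`").
Hence it suffices to verify the DLR equations on any **cofinal** family of finite volumes (e.g. the
centred boxes `[-n, n]^d` of `ℤ^d`, or the intervals `[-n, n]` of `ℤ`): this is how infinite-volume
Gibbs measures built as limits, or as stationary Markov chains in one dimension, are usually shown
to be Gibbs measures (Georgii 2011, Remark 1.24 and §4.4; Friedli–Velenik 2017, Remark 6.19).

* `lintegral_lintegral_eq_of_dlr` — the DLR equation for one volume, stated for sets, extends to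
  non-negative measurable observables: `∫ (∫ f dγ_Λ(·|η)) dμ(η) = ∫ f dμ` (Mathlib `Measure.bind`,
  `Measure.lintegral_bind`);
* `dlr_of_subset` — **Georgii's Remark 1.24**: DLR for `Λ'` and consistency give DLR for `Λ ⊆ Λ'`;
* `isGibbsMeasure_of_cofinal` — DLR on a cofinal family of volumes gives `IsGibbsMeasure γ μ`;
* `IsSpecification.isGibbsMeasure_of_cofinal` — the same for a genuine specification
  `IsSpecification γ` (measurability and consistency are then axioms).

Only plain measurability of `η ↦ γ_Λ(A | η)` for the full product σ-algebra and consistency are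
used — not properness, and not that the `γ Λ η` are probability measures — so the lemmas apply
verbatim to specifications with an unbounded (σ-finite) a priori measure once their consistency
is known.

## References

* H.-O. Georgii, *Gibbs Measures and Phase Transitions*, 2nd ed., de Gruyter (2011), Def. 1.23,
  eq. (1.21), Remark 1.24. [Georgii2011]
* S. Friedli, Y. Velenik, *Statistical Mechanics of Lattice Systems*, CUP (2017), §6.3.1,
  Remark 6.19.
-/

noncomputable section

open MeasureTheory ProbabilityTheory
open scoped ENNReal

namespace Literature.Probability.LatticeModels

variable {V S : Type*} [MeasurableSpace S]

/-- **The DLR equation for observables (lower Lebesgue integral form).** If `η ↦ γ_Λ(A | η)` is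
measurable for every measurable `A` and `∫ γ_Λ(A | η) dμ(η) = μ(A)` for every measurable `A`, then
`∫ (∫ f dγ_Λ(· | η)) dμ(η) = ∫ f dμ` for every measurable `f ≥ 0` (the set-wise DLR equation says
`μ.bind (γ Λ) = μ`; Mathlib `Measure.lintegral_bind`) (Georgii 2011, Remark 1.24, `μ γ_Λ = μ`).
[cite: Georgii2011, Rem. 1.24] -/
theorem lintegral_lintegral_eq_of_dlr {γ : Specification V S} {μ : Measure (V → S)}
    {Λ : Finset V} (hmeas : ∀ A : Set (V → S), MeasurableSet A → Measurable fun η => γ Λ η A)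
    (hDLR : ∀ A : Set (V → S), MeasurableSet A → ∫⁻ η, γ Λ η A ∂μ = μ A)
    {f : (V → S) → ℝ≥0∞} (hf : Measurable f) :
    ∫⁻ η, ∫⁻ σ, f σ ∂(γ Λ η) ∂μ = ∫⁻ σ, f σ ∂μ := by
  have hκ : Measurable (γ Λ) := Measure.measurable_of_measurable_coe _ hmeas
  have hbind : μ.bind (γ Λ) = μ := by
    ext A hA
    rw [Measure.bind_apply hA hκ.aemeasurable]
    exact hDLR A hA
  rw [← Measure.lintegral_bind hκ.aemeasurable (hbind.symm ▸ hf.aemeasurable), hbind]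

/-- **Georgii's Remark 1.24: DLR for a larger volume and consistency give DLR for the smaller
volume.** If `Λ ⊆ Λ'`, the kernels `γ_Λ`, `γ_{Λ'}` are measurable in the boundary condition,
`γ_{Λ'} γ_Λ = γ_{Λ'}` (consistency, Georgii 2011, Def. 1.23 (iii)) and `μ γ_{Λ'} = μ`, then
`μ γ_Λ = μ γ_{Λ'} γ_Λ = μ γ_{Λ'} = μ`. [cite: Georgii2011, Rem. 1.24] -/
theorem dlr_of_subset {γ : Specification V S} {μ : Measure (V → S)} {Λ Λ' : Finset V}
    (hmeasΛ : ∀ A : Set (V → S), MeasurableSet A → Measurable fun η => γ Λ η A)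
    (hmeasΛ' : ∀ A : Set (V → S), MeasurableSet A → Measurable fun η => γ Λ' η A)
    (hcons : ∀ (η : V → S) (A : Set (V → S)), MeasurableSet A →
      ∫⁻ σ, γ Λ σ A ∂(γ Λ' η) = γ Λ' η A)
    (hDLR : ∀ A : Set (V → S), MeasurableSet A → ∫⁻ η, γ Λ' η A ∂μ = μ A)
    (A : Set (V → S)) (hA : MeasurableSet A) : ∫⁻ η, γ Λ η A ∂μ = μ A := by
  calc ∫⁻ η, γ Λ η A ∂μ = ∫⁻ η, ∫⁻ σ, γ Λ σ A ∂(γ Λ' η) ∂μ :=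
        (lintegral_lintegral_eq_of_dlr hmeasΛ' hDLR (hmeasΛ A hA)).symm
    _ = ∫⁻ η, γ Λ' η A ∂μ := lintegral_congr fun η => hcons η A hA
    _ = μ A := hDLR A hA

/-- **DLR equations on a cofinal family of volumes suffice.** Let the kernels of `γ` be measurable
in the boundary condition and consistent (`γ_{Λ'} γ_Λ = γ_{Λ'}` for `Λ ⊆ Λ'`). If `μ` is a
probability measure satisfying `μ γ_{Λ'} = μ` for every `Λ'` in a family `𝓛` of finite volumes
that is cofinal (every finite `Λ` lies in some `Λ' ∈ 𝓛`), then `μ` is a Gibbs measure for `γ`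
(Georgii 2011, Remark 1.24; Friedli–Velenik 2017, Remark 6.19). [cite: Georgii2011, Rem. 1.24] -/
theorem isGibbsMeasure_of_cofinal {γ : Specification V S} {μ : Measure (V → S)}
    [IsProbabilityMeasure μ]
    (hmeas : ∀ (Λ : Finset V) (A : Set (V → S)), MeasurableSet A → Measurable fun η => γ Λ η A)
    (hcons : ∀ ⦃Λ Λ' : Finset V⦄, Λ ⊆ Λ' → ∀ (η : V → S) (A : Set (V → S)), MeasurableSet A →
      ∫⁻ σ, γ Λ σ A ∂(γ Λ' η) = γ Λ' η A)
    {𝓛 : Set (Finset V)} (hcof : ∀ Λ : Finset V, ∃ Λ' ∈ 𝓛, Λ ⊆ Λ')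
    (hDLR : ∀ Λ' ∈ 𝓛, ∀ A : Set (V → S), MeasurableSet A → ∫⁻ η, γ Λ' η A ∂μ = μ A) :
    IsGibbsMeasure γ μ := by
  refine ⟨inferInstance, fun Λ A hA => ?_⟩
  obtain ⟨Λ', hΛ', hsub⟩ := hcof Λ
  exact dlr_of_subset (hmeas Λ) (hmeas Λ') (hcons hsub) (hDLR Λ' hΛ') A hA

/-- **DLR equations on a cofinal family of volumes suffice, for a specification.** For
`IsSpecification γ` (measurability in the boundary condition and consistency are axioms,
Georgii 2011, Def. 1.23 (ii)–(iii)), a probability measure satisfying the DLR equations for all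
volumes of a cofinal family `𝓛` is a Gibbs measure (Georgii 2011, Remark 1.24).
[cite: Georgii2011, Rem. 1.24] -/
theorem IsSpecification.isGibbsMeasure_of_cofinal {γ : Specification V S}
    (hγ : IsSpecification γ) {μ : Measure (V → S)} [IsProbabilityMeasure μ]
    {𝓛 : Set (Finset V)} (hcof : ∀ Λ : Finset V, ∃ Λ' ∈ 𝓛, Λ ⊆ Λ')
    (hDLR : ∀ Λ' ∈ 𝓛, ∀ A : Set (V → S), MeasurableSet A → ∫⁻ η, γ Λ' η A ∂μ = μ A) :
    IsGibbsMeasure γ μ :=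
  Literature.Probability.LatticeModels.isGibbsMeasure_of_cofinal
    (fun Λ _ hA => (hγ.measurable Λ _ hA).mono cylinderEvents_le_pi le_rfl)
    (fun _ _ h η A hA => hγ.consistent h η A hA) hcof hDLR

/-- **Boxes.** On `ℤ`, the DLR equations for the intervals `{-n, …, n}` (`n ∈ ℕ`) suffice: every
finite `Λ ⊆ ℤ` lies in such an interval (Georgii 2011, Remark 1.24, the standard use for
one-dimensional systems). [cite: Georgii2011, Rem. 1.24] -/
theorem isGibbsMeasure_of_forall_Icc {S : Type*} [MeasurableSpace S] {γ : Specification ℤ S}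
    {μ : Measure (ℤ → S)} [IsProbabilityMeasure μ]
    (hmeas : ∀ (Λ : Finset ℤ) (A : Set (ℤ → S)), MeasurableSet A → Measurable fun η => γ Λ η A)
    (hcons : ∀ ⦃Λ Λ' : Finset ℤ⦄, Λ ⊆ Λ' → ∀ (η : ℤ → S) (A : Set (ℤ → S)), MeasurableSet A →
      ∫⁻ σ, γ Λ σ A ∂(γ Λ' η) = γ Λ' η A)
    (hDLR : ∀ (n : ℕ) (A : Set (ℤ → S)), MeasurableSet A →
      ∫⁻ η, γ (Finset.Icc (-(n : ℤ)) n) η A ∂μ = μ A) :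
    IsGibbsMeasure γ μ := by
  refine isGibbsMeasure_of_cofinal hmeas hcons
    (𝓛 := Set.range fun n : ℕ => Finset.Icc (-(n : ℤ)) n) (fun Λ => ?_) ?_
  · -- `Λ ⊆ [-n, n]` for `n` the maximum of `|x|`, `x ∈ Λ`
    obtain ⟨n, hn⟩ : ∃ n : ℕ, ∀ x ∈ Λ, |x| ≤ n := by
      refine ⟨Λ.sup fun x => (|x|).toNat, fun x hx => ?_⟩
      have h := Finset.le_sup (f := fun x => (|x|).toNat) hx
      have h' : ((|x|).toNat : ℤ) = |x| := Int.toNat_of_nonneg (abs_nonneg x)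
      calc |x| = ((|x|).toNat : ℤ) := h'.symm
        _ ≤ _ := by exact_mod_cast h
    refine ⟨_, ⟨n, rfl⟩, fun x hx => ?_⟩
    have h := hn x hx
    rw [abs_le] at h
    exact Finset.mem_Icc.2 h
  · rintro _ ⟨n, rfl⟩ A hA
    exact hDLR n A hA

end Literature.Probability.LatticeModels
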